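import Summits.HubbardSuperconductivity.HubbardSuperconductivity.Theses.FunctionFieldCertificate
import Summits.HubbardSuperconductivity.HubbardSuperconductivity.Theorems.FunctionFieldCertificateMesoscopicPairOrderNecessity
import Summits.HubbardSuperconductivity.HubbardSuperconductivity.Theorems.FunctionFieldCertificateMesoscopicPairOrderStubBoxExpectation
import Summits.HubbardSuperconductivity.HubbardSuperconductivity.Theorems.FunctionFieldCertificateMesoscopicPairOrderStubChordFloor
import Summits.HubbardSuperconductivity.HubbardSuperconductivity.Theorems.NoGoNogoSingletPairKillsSaturatedFM
import Summits.HubbardSuperconductivity.HubbardSuperconductivity.Theorems.DeformationLadderLowEnergyRigidityKernelStates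
import Summits.HubbardSuperconductivity.HubbardSuperconductivity.Theorems.BalabanIRBirEveryGroundStateSocket
import Literature.Barriers.HubbardSuperconductivity.PureModelStripeCompetition
import HarnessLib

/-!
# Disproof of `MesoscopicPairOrder` (stmt-HubbardSuperconductivity-7331) — findings

Crux (route `FunctionFieldCertificate`, pole-free half): `∃ U > 0, δ ∈ (0,1/2), m > 0, ∀ R₀ ∃ R ≥ R₀
∃ L₀ ∀ even L ≥ L₀ ∀ normalised (N_L, S^z = 0)-sector ground states ψ of hubbardTorus 2 L 1 U :
m R² ≤ T_R(ψ)/L²`, `T_R(ψ) = Σ_{x,y} Πᵢ (1 - |(y-x)ᵢ|_L/R)₊ Re⟨P_x ψ, P_y ψ⟩`,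
`P_x = localPair dWaveFormFactor L x`, `N_L = 2⌊(1-δ)L²/2⌋`.

## Findings (cycle 1, refuter-cdisprove-stmt-HubbardSuperconductivity-7331-0)

* **STATUS — no kill is possible short of settling the summit negatively.** The tree proves
  `HubbardSuperconductivity → MesoscopicPairOrder`
  (`Theorems.FunctionFieldCertificate.mesoscopicPairOrder_of_hubbardSuperconductivity`, Fejér floor),
  hence `¬ MesoscopicPairOrder → ¬ HubbardSuperconductivity`
  (`not_hubbardSuperconductivity_of_not_mesoscopicPairOrder`): an unconditional `¬ crux` is a
  rigorous proof of ABSENCE of `d`-wave pair order at EVERY `(U, δ) ∈ (0,∞) × (0,1/2)` along some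
  even-side ground-state sequence — the thesis of route `NoGo` restricted to the audited range, open
  (Theorems/NoGoNogoThesis.lean, `nogoThesis_iff_liminf`). Given the pole half `WindowInfraredBound`
  the crux is even EQUIVALENT to the summit (`mesoscopicPairOrder_iff_hubbardSuperconductivity`).
  So this file records what a proof MUST use and where the witness `(U, δ)` can NOT be.
* §0 `MesoscopicPairOrderAt U δ` (pointwise body) and `mesoscopicPairOrder_iff_exists_at` (`Iff.rfl`).
* §1 LOAD-BEARING HYPOTHESES (all sorry-free):
  - `mesoscopicPairOrder_false_without_groundState`: replacing "ground state in the sector" by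
    "unit vector in the sector" is FALSE at every `(U, δ)` — explicit row-separated `↑/↓` Slater
    states (`exists_unit_localKernel_state`, all `P_x` kill them, `T_R = 0`); so sector + density
    information alone carries no pair order: minimality is the whole content.
  - `mesoscopicPairOrder_false_without_normalisation`: dropping `star ψ ⬝ᵥ ψ = 1` is FALSE
    (rescaled ground states, `T_R(cψ) = |c|² T_R(ψ)`); harmless but the prover must carry the norm.
  - `body_holds_at_scale_zero`: at `R = 0` the weight is the junk constant `1` (`x / 0 = 0`) and the
    inequality `m·0 ≤ ‖Δψ‖²/L²` holds for EVERY vector: only `R₀ ≥ 1` has content (a prover may NOT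
    read anything into the `R₀ = 0` instance; a refuter must start at `R₀ = 1`).
  - §1d CEILING `boxCorr_le_sq_mul_localWeight`: `T_R(ψ) ≤ R² Σ_x ‖P_x ψ‖²` (tent identity +
    Cauchy–Schwarz), so `localWeight_ge_margin_of_mesoscopicPairOrderAt`: the margin `m` is at most
    the eventual minimal local pair weight `L⁻² Σ_x ‖P_x ψ‖²` over ALL sector ground states (≤ 32; in
    spin language ≤ 8 × nearest-neighbour singlet density `⟨n_x n_y/4 - S_x·S_y⟩`).
* §2 EXCLUSION REGION (where the witness cannot be), sorry-free:
  `mesoscopicPairOrderAt_false_of_saturated` — if for infinitely many even `L` the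
  `(N_L, S^z = 0)` sector of `hubbardTorus 2 L 1 U` has a SATURATED ferromagnetic ground state
  (`S² ψ = n(n+1)ψ`, `n = N_L/2`; Nagaoka regime), then `¬ MesoscopicPairOrderAt U δ` (every singlet
  pair operator kills a saturated ferromagnet: tree `NoGo.localPair_mulVec_eq_zero_of_saturated`).
  Corollary `mesoscopicPairOrder_false_of_ubiquitous_saturation`: the SHAPE of a kill — saturated
  ferromagnetism i.o. at every `(U, δ)` — physically false at small `U`, recorded only as the
  reduction. Dually `eventually_no_saturated_groundState_of_mesoscopicPairOrderAt`.
* §3 LINE `Sketch` (lead's picked line; its only open stub `stub_chordGap` is the crux in stateless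
  form by the tree's Danskin file): `ChordGapAt`, `mesoscopicPairOrderAt_of_chordGapAt` (pointwise
  composition through the LANDED stubs `stub_chordFloor`, `stub_boxExpectation`) and
  `chordGapAt_false_of_saturated` — the stub dies on the same exclusion region; joint sufficiency of
  the line is honest (no smuggled gap): the composition is kernel-checked here pointwise.
* §4 NEAR-MISSES / WHY IT RESISTS (docstrings; the one `sorry` of this file is the crux's negation
  itself, kept as the target statement `not_mesoscopicPairOrder_target` with the obstruction).
  Numerics say the crux is plausibly FALSE on the route's own window (Qin et al. PRX 10 (2020)
  031016: filled stripes, `Δ_∞ = 0.003(6)` at `(8, 1/8)`, `0.006(4)` at `(4, 1/6)`; Xu et al.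
  Science 384 (2024): `t' = 0` ⇒ stripes, no SC; barrier `PureModelStripeCompetition`), and
  plausibly TRUE only at weak coupling / larger doping (Raghu–Kivelson–Scalapino 2010, Deng et al.
  2015: `U ≲ 4`, `δ ≳ 0.3`) where `m ~ e^{-c (t/U)²}` is astronomically small — but no rigorous tool
  decides either: no sign-free QMC, no reflection positivity off half filling, no convergent
  expansion at `T = 0` in `d = 2` for itinerant fermions with a Fermi surface.

All theorems below are sorry-free except the explicitly marked target in §4.
-/

noncomputable section

-- the summit namespace repeats the problem name by design (D-0017)
set_option linter.dupNamespace false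

namespace Summit.HubbardSuperconductivity.HubbardSuperconductivity.Cruxes.MesoscopicPairOrder.Disproof

open Matrix Finset Filter
open Literature.Probability.LatticeModels Literature.MathematicalPhysics.QuantumLattice
open Summit.HubbardSuperconductivity.HubbardSuperconductivity.Theses.FunctionFieldCertificate
open scoped ComplexOrder

/-! ### §0 The pointwise body -/

/-- The Fejér (tent) weight `W_R(y - x) = Πᵢ (1 - |(y - x)ᵢ|_L / R)₊` of the crux, verbatim.
JUNK at `R = 0`: `|·| / 0 = 0`, so `W_0 ≡ 1` (`fejerWeight_zero`). [folklore] -/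
def fejerWeight (L : ℕ) (R : ℕ) (x y : TorusSite 2 L) : ℝ :=
  ∏ i : Fin 2, max 0 (1 - |(((y i - x i).valMinAbs : ℤ) : ℝ)| / (R : ℝ))

/-- The Fejér-box pair functional `T_R(ψ) = Σ_{x,y} W_R(y - x) Re⟨P_x ψ, P_y ψ⟩` of the crux,
verbatim (`P_x = localPair dWaveFormFactor L x`). [folklore] -/
def boxCorr (L : ℕ) [NeZero L] (R : ℕ) (ψ : Fock (Orb (FermionTorus 2 L))) : ℝ :=
  ∑ x : TorusSite 2 L, ∑ y : TorusSite 2 L, fejerWeight L R x y *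
    (star (localPair dWaveFormFactor L x *ᵥ ψ) ⬝ᵥ (localPair dWaveFormFactor L y *ᵥ ψ)).re

/-- **The crux at fixed parameters** `(U, δ)`: the body of `MesoscopicPairOrder` after its two
leading existentials. [folklore] -/
def MesoscopicPairOrderAt (U δ : ℝ) : Prop :=
  ∃ m : ℝ, 0 < m ∧ ∀ R₀ : ℕ, ∃ R : ℕ, R₀ ≤ R ∧ ∃ L₀ : ℕ, ∀ (L : ℕ) [NeZero L], L₀ ≤ L → Even L →
    ∀ ψ : Fock (Orb (FermionTorus 2 L)), star ψ ⬝ᵥ ψ = 1 →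
      IsGroundStateInSector (hubbardTorus 2 L 1 U) (2 * ⌊(1 - δ) * (L : ℝ) ^ 2 / 2⌋₊) 0 ψ →
        m * (R : ℝ) ^ 2 ≤ boxCorr L R ψ / (L : ℝ) ^ 2

/-- `MesoscopicPairOrder ↔ ∃ U > 0, ∃ δ ∈ (0, 1/2), MesoscopicPairOrderAt U δ` (definitional).
[folklore] -/
theorem mesoscopicPairOrder_iff_exists_at :
    MesoscopicPairOrder ↔ ∃ U : ℝ, 0 < U ∧ ∃ δ ∈ Set.Ioo (0:ℝ) (1 / 2), MesoscopicPairOrderAt U δ :=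
  Iff.rfl

/-- At scale `R = 0` the weight is the junk constant `1`. [folklore] -/
theorem fejerWeight_zero (L : ℕ) (x y : TorusSite 2 L) : fejerWeight L 0 x y = 1 := by
  simp [fejerWeight]

/-- If every local pair operator kills `ψ`, the box functional vanishes at every scale. [folklore] -/
theorem boxCorr_eq_zero_of_forall_localPair_eq_zero (L : ℕ) [NeZero L] (R : ℕ)
    {ψ : Fock (Orb (FermionTorus 2 L))} (h : ∀ x : TorusSite 2 L, localPair dWaveFormFactor L x *ᵥ ψ = 0) :
    boxCorr L R ψ = 0 := by
  simp [boxCorr, h]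

/-! ### §1 Load-bearing hypotheses -/

/-! #### §1a The ground-state clause: explicit unit vectors of the sector killed by every `P_x` -/

/-- Local form of `Theorems.hcf_pairField_mulVec_single_eq_zero`: if no step `e ∈ {0, ±e₁, ±e₂}`
joins an occupied `↑` orbital at `x` to an occupied `↓` orbital at `x + e` of the occupation set
`s₀` (either order), then the local pair `P_x` kills the basis state `|s₀⟩`, for every form factor.
[folklore] -/
theorem localPair_mulVec_single_eq_zero (L : ℕ) [NeZero L] (g : Site 2 → ℝ)
    (s₀ : Finset (Orb (FermionTorus 2 L))) (x : TorusSite 2 L)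
    (h : ∀ e ∈ insert (0 : Site 2) unitSteps,
      ¬ (orb (FermionTorus.ofTorusSite x) 0 ∈ s₀ ∧
          orb (FermionTorus.ofTorusSite (x + Torus.proj L e)) 1 ∈ s₀) ∧
      ¬ (orb (FermionTorus.ofTorusSite x) 1 ∈ s₀ ∧
          orb (FermionTorus.ofTorusSite (x + Torus.proj L e)) 0 ∈ s₀)) :
    localPair g L x *ᵥ Pi.single s₀ (1 : ℂ) = 0 := by
  rw [localPair, sum_mulVec]
  refine sum_eq_zero fun e he => ?_
  rw [smul_mulVec, sub_mulVec]
  have h1 : (annihilation (orb (FermionTorus.ofTorusSite x) 0) *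
      annihilation (orb (FermionTorus.ofTorusSite (x + Torus.proj L e)) 1)) *ᵥ Pi.single s₀ (1 : ℂ) = 0 := by
    convert Theorems.hcf_annihilation_mul_annihilation_mulVec_single_eq_zero _ _ _ (h e he).1 using 3
  have h2 : (annihilation (orb (FermionTorus.ofTorusSite x) 1) *
      annihilation (orb (FermionTorus.ofTorusSite (x + Torus.proj L e)) 0)) *ᵥ Pi.single s₀ (1 : ℂ) = 0 := by
    convert Theorems.hcf_annihilation_mul_annihilation_mulVec_single_eq_zero _ _ _ (h e he).2 using 3
  rw [h1, h2, sub_zero, smul_zero]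

/-- **Explicit unit LOCAL kernel states.** For `2 ≤ L` and `2m + 3L ≤ L²` there is a unit vector of
the joint sector `(N, S^z) = (2m, 0)` killed by EVERY local `d`-wave pair operator `P_x` (not only
by their sum `Δ_d`): the occupation basis state with the `m` `↑`-electrons on the sites of rank
`< m` and the `m` `↓`-electrons on the sites of rank in `[m + 2L, 2m + 2L)` (rank `x₀ + L x₁`), two
rows apart (tree: `Theorems.hcf_rowSeparated_no_neighbours`). [folklore] -/
theorem exists_unit_localKernel_state (L : ℕ) [NeZero L] (hL : 2 ≤ L) {m : ℕ}
    (hm : 2 * m + 3 * L ≤ L ^ 2) :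
    ∃ φ : Fock (Orb (FermionTorus 2 L)), φ ∈ szSector (Λ := FermionTorus 2 L) (2 * m) 0 ∧
      star φ ⬝ᵥ φ = 1 ∧ ∀ x : TorusSite 2 L, localPair dWaveFormFactor L x *ᵥ φ = 0 := by
  set rank : FermionTorus 2 L → ℕ := fun x => ((finFunctionFinEquiv (ofLex x) : Fin (L ^ 2)) : ℕ)
    with hrank
  set A : Finset (FermionTorus 2 L) := univ.filter fun x => rank x < m with hA_def
  set B : Finset (FermionTorus 2 L) :=
    (univ.filter fun x => rank x < 2 * m + 2 * L) \ (univ.filter fun x => rank x < m + 2 * L) with hB_def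
  have hAcard : A.card = m := by
    rw [hA_def, Theorems.hcf_card_filter_rank_lt]
    exact min_eq_right (by omega)
  have hBcard : B.card = m := by
    rw [hB_def, card_sdiff_of_subset (fun x hx => by
      simp only [mem_filter, mem_univ, true_and] at hx ⊢; omega),
      Theorems.hcf_card_filter_rank_lt, Theorems.hcf_card_filter_rank_lt, min_eq_right (by omega),
      min_eq_right (by omega)]
    omega
  have hmemB : ∀ y, y ∈ B ↔ m + 2 * L ≤ rank y ∧ rank y < 2 * m + 2 * L := fun y => by
    rw [hB_def, Finset.mem_sdiff, Finset.mem_filter, Finset.mem_filter]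
    simp only [Finset.mem_univ, true_and, not_lt]
    tauto
  refine ⟨Pi.single (pairSet A B) 1, Theorems.hcf_single_pairSet_mem_szSector L A B hAcard hBcard,
    by simp, fun x => ?_⟩
  refine localPair_mulVec_single_eq_zero L dWaveFormFactor (pairSet A B) x fun e he => ?_
  have hPA : ∀ y : TorusSite 2 L, FermionTorus.ofTorusSite y ∈ A ↔ (y 0).val + L * (y 1).val < m := by
    intro y
    simp only [hA_def, mem_filter, mem_univ, true_and, hrank]
    rw [Theorems.hcf_rank_ofTorusSite]
  have hQB : ∀ y : TorusSite 2 L, FermionTorus.ofTorusSite y ∈ B ↔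
      m + 2 * L ≤ (y 0).val + L * (y 1).val ∧ (y 0).val + L * (y 1).val < 2 * m + 2 * L := by
    intro y
    rw [hmemB]
    simp only [hrank]
    rw [Theorems.hcf_rank_ofTorusSite]
  have hsep := Theorems.hcf_rowSeparated_no_neighbours L hL hm x e he
    (fun y => FermionTorus.ofTorusSite y ∈ A) (fun y => FermionTorus.ofTorusSite y ∈ B) hPA hQB
  rw [Theorems.hcf_orb_mem_pairSet_iff, Theorems.hcf_orb_mem_pairSet_iff,
    Theorems.hcf_orb_mem_pairSet_iff, Theorems.hcf_orb_mem_pairSet_iff]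
  simp only [Fin.isValue, true_and, zero_ne_one, one_ne_zero, false_and, or_false, false_or]
  exact hsep

/-- The route's pair number fits with two spare rows once `3 ≤ δ L`:
`2⌊(1-δ)L²/2⌋ + 3L ≤ L²`. [folklore] -/
theorem pairNumber_rows_le (L : ℕ) {δ : ℝ} (hδ1 : δ ≤ 1) (hδL : 3 ≤ δ * L) :
    2 * ⌊(1 - δ) * (L : ℝ) ^ 2 / 2⌋₊ + 3 * L ≤ L ^ 2 := by
  have h1 : ((⌊(1 - δ) * (L : ℝ) ^ 2 / 2⌋₊ : ℕ) : ℝ) ≤ (1 - δ) * (L : ℝ) ^ 2 / 2 := by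
    refine Nat.floor_le ?_
    have : 0 ≤ 1 - δ := by linarith
    positivity
  have hL : (0 : ℝ) ≤ L := Nat.cast_nonneg L
  have h2 : (2 * ⌊(1 - δ) * (L : ℝ) ^ 2 / 2⌋₊ + 3 * L : ℝ) ≤ (L : ℝ) ^ 2 := by nlinarith
  exact_mod_cast h2

/-- **At every `(U, δ)` with `δ > 0` and every large even side the sector contains a unit vector
with `T_R = 0` at all scales** (the local kernel state at the route's density). [folklore] -/
theorem exists_unit_sector_state_boxCorr_eq_zero {δ : ℝ} (hδ : δ ∈ Set.Ioo (0:ℝ) (1 / 2))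
    (L : ℕ) [NeZero L] (hL : 2 ≤ L) (hδL : 3 ≤ δ * L) :
    ∃ φ : Fock (Orb (FermionTorus 2 L)),
      φ ∈ szSector (Λ := FermionTorus 2 L) (2 * ⌊(1 - δ) * (L : ℝ) ^ 2 / 2⌋₊) 0 ∧
        star φ ⬝ᵥ φ = 1 ∧ ∀ R : ℕ, boxCorr L R φ = 0 := by
  obtain ⟨φ, hφS, hφ1, hφ0⟩ := exists_unit_localKernel_state L hL
    (pairNumber_rows_le L (by linarith [hδ.2]) hδL)
  exact ⟨φ, hφS, hφ1, fun R => boxCorr_eq_zero_of_forall_localPair_eq_zero L R hφ0⟩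

/-- The crux with its ground-state clause WEAKENED to bare sector membership (density and `S^z`
kept, minimality dropped). -/
def MesoscopicPairOrderWithoutGroundState : Prop :=
  ∃ U : ℝ, 0 < U ∧ ∃ δ ∈ Set.Ioo (0:ℝ) (1 / 2), ∃ m : ℝ, 0 < m ∧ ∀ R₀ : ℕ, ∃ R : ℕ, R₀ ≤ R ∧
    ∃ L₀ : ℕ, ∀ (L : ℕ) [NeZero L], L₀ ≤ L → Even L →
      ∀ ψ : Fock (Orb (FermionTorus 2 L)), star ψ ⬝ᵥ ψ = 1 →
        ψ ∈ szSector (Λ := FermionTorus 2 L) (2 * ⌊(1 - δ) * (L : ℝ) ^ 2 / 2⌋₊) 0 →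
          m * (R : ℝ) ^ 2 ≤ boxCorr L R ψ / (L : ℝ) ^ 2

/-- A convenient large even side: `L = 2(L₀ + ⌈3/δ⌉₊ + 1)` is even, `≥ L₀`, `≥ 2`, nonzero and has
`3 ≤ δ L`. [folklore] -/
theorem exists_good_side (L₀ : ℕ) {δ : ℝ} (hδ : 0 < δ) :
    ∃ L : ℕ, L₀ ≤ L ∧ Even L ∧ 2 ≤ L ∧ 3 ≤ δ * L := by
  refine ⟨2 * (L₀ + ⌈3 / δ⌉₊ + 1), by omega, ⟨L₀ + ⌈3 / δ⌉₊ + 1, by ring⟩, by omega, ?_⟩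
  have hc : 3 / δ ≤ (⌈3 / δ⌉₊ : ℝ) := Nat.le_ceil _
  have h3 : 3 ≤ δ * (⌈3 / δ⌉₊ : ℝ) := by
    calc (3 : ℝ) = δ * (3 / δ) := by field_simp
      _ ≤ δ * (⌈3 / δ⌉₊ : ℝ) := by gcongr
  push_cast
  nlinarith [Nat.cast_nonneg (α := ℝ) L₀, Nat.cast_nonneg (α := ℝ) ⌈3 / δ⌉₊]

/-- **Any proof must use minimality**: the crux with "ground state in the sector" weakened to
"unit vector in the sector" is FALSE — at every `(U, δ)`, every margin and every scale `R ≥ 1`,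
the row-separated `↑/↓` Slater state of the sector has `T_R = 0`. [folklore] -/
theorem mesoscopicPairOrder_false_without_groundState : ¬ MesoscopicPairOrderWithoutGroundState := by
  rintro ⟨U, -, δ, hδ, m, hm, h⟩
  obtain ⟨R, hR, L₀, hL⟩ := h 1
  obtain ⟨L, hL₀, hEven, hL2, hδL⟩ := exists_good_side L₀ hδ.1
  haveI : NeZero L := ⟨by omega⟩
  obtain ⟨φ, hφS, hφ1, hφ0⟩ := exists_unit_sector_state_boxCorr_eq_zero hδ L hL2 hδL
  have hbad := hL L hL₀ hEven φ hφ1 hφS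
  rw [hφ0 R, zero_div] at hbad
  have hRpos : (1 : ℝ) ≤ R := by exact_mod_cast hR
  have hR2 : (1 : ℝ) ≤ (R : ℝ) ^ 2 := by nlinarith
  have hmR : m ≤ m * (R : ℝ) ^ 2 := le_mul_of_one_le_right hm.le hR2
  linarith


/-! #### §1b The normalisation clause: rescaled ground states -/

/-- `T_R(c ψ) = |c|² T_R(ψ)`. [folklore] -/
theorem boxCorr_smul (L : ℕ) [NeZero L] (R : ℕ) (c : ℂ) (ψ : Fock (Orb (FermionTorus 2 L))) :
    boxCorr L R (c • ψ) = ‖c‖ ^ 2 * boxCorr L R ψ := by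
  unfold boxCorr
  rw [Finset.mul_sum]
  refine Finset.sum_congr rfl fun x _ => ?_
  rw [Finset.mul_sum]
  refine Finset.sum_congr rfl fun y _ => ?_
  rw [mulVec_smul, mulVec_smul, star_smul, smul_dotProduct, dotProduct_smul, smul_smul, smul_eq_mul,
    Complex.star_def, ← Complex.normSq_eq_conj_mul_self, Complex.normSq_eq_norm_sq,
    Complex.re_ofReal_mul]
  ring

/-- The crux with its normalisation clause `star ψ ⬝ᵥ ψ = 1` DROPPED (ground states of any norm). -/
def MesoscopicPairOrderWithoutNormalisation : Prop :=
  ∃ U : ℝ, 0 < U ∧ ∃ δ ∈ Set.Ioo (0:ℝ) (1 / 2), ∃ m : ℝ, 0 < m ∧ ∀ R₀ : ℕ, ∃ R : ℕ, R₀ ≤ R ∧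
    ∃ L₀ : ℕ, ∀ (L : ℕ) [NeZero L], L₀ ≤ L → Even L →
      ∀ ψ : Fock (Orb (FermionTorus 2 L)),
        IsGroundStateInSector (hubbardTorus 2 L 1 U) (2 * ⌊(1 - δ) * (L : ℝ) ^ 2 / 2⌋₊) 0 ψ →
          m * (R : ℝ) ^ 2 ≤ boxCorr L R ψ / (L : ℝ) ^ 2

/-- **Any proof must carry the normalisation**: without `star ψ ⬝ᵥ ψ = 1` the crux is FALSE —
`IsGroundStateInSector` is homogeneous (`NoGo.isGroundStateInSector_smul`), ground states exist in
the sector at every side (`NoGo.exists_unit_groundStateInSector_hubbardTorus`), and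
`T_R(cψ₀) = |c|² T_R(ψ₀) → 0` as `c → 0` while `m R² ≥ m > 0` for `R ≥ 1`. (Trivial, but it is the
exact reason the crux normalises `ψ` instead of dividing by `‖ψ‖²`.) [folklore] -/
theorem mesoscopicPairOrder_false_without_normalisation : ¬ MesoscopicPairOrderWithoutNormalisation := by
  rintro ⟨U, -, δ, hδ, m, hm, h⟩
  obtain ⟨R, hR, L₀, hL⟩ := h 1
  obtain ⟨L, hL₀, hEven, hL2, -⟩ := exists_good_side L₀ hδ.1
  haveI : NeZero L := ⟨by omega⟩
  have hδ' : (-1 : ℝ) ≤ δ := by linarith [hδ.1]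
  obtain ⟨ψ₀, -, hgs⟩ :=
    Summit.HubbardSuperconductivity.NoGo.exists_unit_groundStateInSector_hubbardTorus L 1 U
      (Summit.HubbardSuperconductivity.NoGo.floor_pairNumber_le δ hδ' L)
  set t : ℝ := boxCorr L R ψ₀ with ht
  have hRpos : (1 : ℝ) ≤ R := by exact_mod_cast hR
  have hLpos : (0 : ℝ) < L := by exact_mod_cast (show 0 < L by omega)
  have hmRL : 0 < m * (R : ℝ) ^ 2 * (L : ℝ) ^ 2 := by positivity
  have ht1 : 0 < |t| + 1 := by positivity
  set ε : ℝ := m * (R : ℝ) ^ 2 * (L : ℝ) ^ 2 / (2 * (|t| + 1)) with hε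
  have hεpos : 0 < ε := by positivity
  set c : ℂ := ((Real.sqrt ε : ℝ) : ℂ) with hc
  have hc0 : c ≠ 0 := by
    rw [hc, Ne, Complex.ofReal_eq_zero]
    exact (Real.sqrt_pos.2 hεpos).ne'
  have hnorm : ‖c‖ ^ 2 = ε := by
    rw [hc, Complex.norm_real, Real.norm_of_nonneg (Real.sqrt_nonneg _), Real.sq_sqrt hεpos.le]
  have hbad := hL L hL₀ hEven (c • ψ₀)
    (Summit.HubbardSuperconductivity.NoGo.isGroundStateInSector_smul _ _ _ hgs hc0)
  rw [boxCorr_smul, hnorm, le_div_iff₀ (by positivity)] at hbad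
  -- `hbad : m R² L² ≤ ε t`, but `ε t ≤ ε |t| < m R² L²`
  have h1 : ε * t ≤ ε * |t| := mul_le_mul_of_nonneg_left (le_abs_self t) hεpos.le
  have h2 : ε * |t| < m * (R : ℝ) ^ 2 * (L : ℝ) ^ 2 := by
    rw [hε, div_mul_eq_mul_div, div_lt_iff₀ (by positivity)]
    have : m * (R : ℝ) ^ 2 * (L : ℝ) ^ 2 * |t| < m * (R : ℝ) ^ 2 * (L : ℝ) ^ 2 * (2 * (|t| + 1)) :=
      mul_lt_mul_of_pos_left (by linarith [abs_nonneg t]) hmRL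
    linarith
  linarith

/-! #### §1c The scale quantifier: `R = 0` is vacuous -/

/-- `Σ_x Σ_y Re⟨v_x, v_y⟩ = Re⟨Σ_x v_x, Σ_y v_y⟩`. [folklore] -/
theorem sum_sum_re_dotProduct_eq {ι n : Type*} [Fintype ι] [Fintype n] (v : ι → n → ℂ) :
    ∑ x, ∑ y, (star (v x) ⬝ᵥ v y).re = (star (∑ x, v x) ⬝ᵥ (∑ y, v y)).re := by
  rw [star_sum, sum_dotProduct, Complex.re_sum]
  refine sum_congr rfl fun x _ => ?_
  rw [dotProduct_sum, Complex.re_sum]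

/-- At `R = 0` the box functional is the full (weight-`1`) pair structure factor
`T_0(ψ) = ‖Δ_d ψ‖² = Re⟨Δ_d ψ, Δ_d ψ⟩` (junk weight `W_0 ≡ 1`). [folklore] -/
theorem boxCorr_zero_eq (L : ℕ) [NeZero L] (ψ : Fock (Orb (FermionTorus 2 L))) :
    boxCorr L 0 ψ =
      (star (pairField dWaveFormFactor L *ᵥ ψ) ⬝ᵥ (pairField dWaveFormFactor L *ᵥ ψ)).re := by
  unfold boxCorr
  simp_rw [fejerWeight_zero, one_mul]
  rw [sum_sum_re_dotProduct_eq, pairField, sum_mulVec]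

/-- **The `R₀ = 0` instance of the crux is vacuous**: at scale `R = 0` the inequality
`m · 0² ≤ T_0(ψ)/L² = ‖Δ_d ψ‖²/L²` holds for EVERY vector `ψ` and every `m`. So the content of the
crux starts at `R₀ = 1` (and a disproof must instantiate `R₀ ≥ 1`, as §§1–2 do). [folklore] -/
theorem body_holds_at_scale_zero (L : ℕ) [NeZero L] (m : ℝ) (ψ : Fock (Orb (FermionTorus 2 L))) :
    m * ((0 : ℕ) : ℝ) ^ 2 ≤ boxCorr L 0 ψ / (L : ℝ) ^ 2 := by
  rw [Nat.cast_zero, zero_pow two_ne_zero, mul_zero, boxCorr_zero_eq]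
  refine div_nonneg ?_ (by positivity)
  exact (Complex.nonneg_iff.1 (dotProduct_star_self_nonneg _)).1

/-! #### §1d Ceiling: the margin is at most the local pair density of every ground state -/

/-- Scalar block reindexing on the torus: `Σ_a Σ_{u ∈ [0,R)²} f(a + u) = R² Σ_x f(x)`. [folklore] -/
theorem sum_sum_block_eq {L : ℕ} [NeZero L] (R : ℕ) (f : TorusSite 2 L → ℝ) :
    ∑ a : TorusSite 2 L, ∑ u : Fin 2 → Fin R, f (a + fun i => ((u i : ℕ) : ZMod L)) =
      (R : ℝ) ^ 2 * ∑ x : TorusSite 2 L, f x := by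
  rw [Finset.sum_comm]
  have h : ∀ u : Fin 2 → Fin R,
      ∑ a : TorusSite 2 L, f (a + fun i => ((u i : ℕ) : ZMod L)) = ∑ x : TorusSite 2 L, f x :=
    fun u => Fintype.sum_equiv (Equiv.addRight _) _ _ fun a => rfl
  simp_rw [h]
  rw [Finset.sum_const, Finset.card_univ, Fintype.card_fun, Fintype.card_fin, Fintype.card_fin,
    nsmul_eq_mul, Nat.cast_pow]

/-- **CEILING `T_R(ψ) ≤ R² Σ_x ‖P_x ψ‖²`** (`0 < R`, `2R ≤ L`): the tent identity
`R² T_R(ψ) = Σ_a ‖B_a ψ‖²` (tree: `FunctionFieldCertificateAssembly.re_sum_star_blockMulVec_dotProduct_eq`,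
blocks `B_a = Σ_{u ∈ [0,R)²} P_{a+u}`) and Cauchy–Schwarz `‖B_a ψ‖² ≤ R² Σ_u ‖P_{a+u} ψ‖²`. Together
with the Fejér FLOOR `R² ‖Δ_d ψ‖²/L² ≤ T_R(ψ)` (`fejerBox_floor_pairField`) this sandwiches the crux's
functional between the `k = 0` mode and the local pair weight. [folklore] -/
theorem boxCorr_le_sq_mul_localWeight (L : ℕ) [NeZero L] (R : ℕ) (hR : 0 < R) (hRL : 2 * R ≤ L)
    (ψ : Fock (Orb (FermionTorus 2 L))) :
    boxCorr L R ψ ≤ (R : ℝ) ^ 2 * ∑ x : TorusSite 2 L,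
      (star (localPair dWaveFormFactor L x *ᵥ ψ) ⬝ᵥ (localPair dWaveFormFactor L x *ᵥ ψ)).re := by
  have htent := Theorems.FunctionFieldCertificateAssembly.re_sum_star_blockMulVec_dotProduct_eq
    (L := L) R hR hRL (localPair dWaveFormFactor L) ψ
  change _ = (R : ℝ) ^ 2 * boxCorr L R ψ at htent
  have hCS : ∀ a : TorusSite 2 L,
      (star ((∑ u : Fin 2 → Fin R, localPair dWaveFormFactor L (a + fun i => ((u i : ℕ) : ZMod L))) *ᵥ ψ) ⬝ᵥ
          ((∑ u : Fin 2 → Fin R, localPair dWaveFormFactor L (a + fun i => ((u i : ℕ) : ZMod L))) *ᵥ ψ)).re ≤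
        (R : ℝ) ^ 2 * ∑ u : Fin 2 → Fin R,
          (star (localPair dWaveFormFactor L (a + fun i => ((u i : ℕ) : ZMod L)) *ᵥ ψ) ⬝ᵥ
            (localPair dWaveFormFactor L (a + fun i => ((u i : ℕ) : ZMod L)) *ᵥ ψ)).re := by
    intro a
    rw [Matrix.sum_mulVec]
    have h := Theorems.FunctionFieldCertificate.re_star_sum_dotProduct_sum_le
      (fun u : Fin 2 → Fin R => localPair dWaveFormFactor L (a + fun i => ((u i : ℕ) : ZMod L)) *ᵥ ψ)
    rwa [Fintype.card_fun, Fintype.card_fin, Fintype.card_fin, Nat.cast_pow] at h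
  have hsum : (∑ a : TorusSite 2 L,
      star ((∑ u : Fin 2 → Fin R, localPair dWaveFormFactor L (a + fun i => ((u i : ℕ) : ZMod L))) *ᵥ ψ) ⬝ᵥ
        ((∑ u : Fin 2 → Fin R, localPair dWaveFormFactor L (a + fun i => ((u i : ℕ) : ZMod L))) *ᵥ ψ)).re ≤
      (R : ℝ) ^ 2 * ((R : ℝ) ^ 2 * ∑ x : TorusSite 2 L,
        (star (localPair dWaveFormFactor L x *ᵥ ψ) ⬝ᵥ (localPair dWaveFormFactor L x *ᵥ ψ)).re) := by
    rw [Complex.re_sum, ← sum_sum_block_eq R (fun x => (star (localPair dWaveFormFactor L x *ᵥ ψ) ⬝ᵥ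
      (localPair dWaveFormFactor L x *ᵥ ψ)).re), Finset.mul_sum]
    exact Finset.sum_le_sum fun a _ => hCS a
  rw [htent] at hsum
  have hR2 : (0 : ℝ) < (R : ℝ) ^ 2 := by positivity
  exact le_of_mul_le_mul_left hsum hR2

/-- **The margin is at most the eventual minimal LOCAL pair density of the ground states**:
if the crux body holds at `(U, δ)` with margin `m`, then for all large even `L` every normalised
sector ground state has local `d`-wave pair weight `s₀(ψ) := L⁻² Σ_x ‖P_x ψ‖² ≥ m`. (So `m ≤ 32`
trivially, `‖P_x‖² ≤ 32`; and since `‖P_x ψ‖² ≤ 2 Σ_e ‖b_{x,x+e} ψ‖²` with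
`b_{xy}ᴴ b_{xy} = 2(n_x n_y/4 - S_x·S_y)`, `m ≤ 8 L⁻² Σ_{⟨xy⟩} ⟨n_x n_y/4 - S_x·S_y⟩_ψ`: the margin
is controlled by the nearest-neighbour SINGLET density of every ground state — a calibration, not an
obstruction; the spin identity is not formalised here.) [folklore] -/
theorem localWeight_ge_margin_of_mesoscopicPairOrderAt {U δ : ℝ} (h : MesoscopicPairOrderAt U δ) :
    ∃ m : ℝ, 0 < m ∧ ∃ L₁ : ℕ, ∀ (L : ℕ) [NeZero L], L₁ ≤ L → Even L →
      ∀ ψ : Fock (Orb (FermionTorus 2 L)), star ψ ⬝ᵥ ψ = 1 →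
        IsGroundStateInSector (hubbardTorus 2 L 1 U) (2 * ⌊(1 - δ) * (L : ℝ) ^ 2 / 2⌋₊) 0 ψ →
          m ≤ (∑ x : TorusSite 2 L,
            (star (localPair dWaveFormFactor L x *ᵥ ψ) ⬝ᵥ (localPair dWaveFormFactor L x *ᵥ ψ)).re) /
              (L : ℝ) ^ 2 := by
  obtain ⟨m, hm, hall⟩ := h
  obtain ⟨R, hR, L₀, hL⟩ := hall 1
  refine ⟨m, hm, max L₀ (2 * R), fun L _ hL₁ hE ψ hψ hgs => ?_⟩
  have hRpos : 0 < R := hR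
  have hRL : 2 * R ≤ L := le_of_max_le_right hL₁
  have hbody := hL L (le_of_max_le_left hL₁) hE ψ hψ hgs
  have hceil := boxCorr_le_sq_mul_localWeight L R hRpos hRL ψ
  have hLpos : (0 : ℝ) < L := Nat.cast_pos.2 (Nat.pos_of_ne_zero (NeZero.ne L))
  have hL2 : (0 : ℝ) < (L : ℝ) ^ 2 := by positivity
  rw [le_div_iff₀ hL2] at hbody ⊢
  have hR2 : (0 : ℝ) < (R : ℝ) ^ 2 := by positivity
  -- `m R² L² ≤ T_R ≤ R² · S`, divide by `R²`
  have : (R : ℝ) ^ 2 * (m * (L : ℝ) ^ 2) ≤ (R : ℝ) ^ 2 * ∑ x : TorusSite 2 L,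
      (star (localPair dWaveFormFactor L x *ᵥ ψ) ⬝ᵥ (localPair dWaveFormFactor L x *ᵥ ψ)).re := by
    nlinarith
  exact le_of_mul_le_mul_left this hR2

/-! ### §2 Exclusion region: saturated (Nagaoka) ferromagnetic sector ground states -/

/-- **Saturated sector ground states, infinitely often along even sides**: for infinitely many even
`L` the `(N_L, S^z = 0)` sector of `hubbardTorus 2 L 1 U` (`N_L = 2n`, `n = ⌊(1-δ)L²/2⌋`) contains
a ground state of maximal total spin, `S² ψ = n(n+1) ψ` (the `S^z = 0` member of the top
multiplet). Expected in a Nagaoka corner `U ≫ 1`, `δ ≪ 1` (Nagaoka 1966, one hole, `U = ∞`;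
finite density OPEN: Tasaki, Prog. Theor. Phys. 99 (1998) 489, p. 21); certainly false at small
`U`. -/
def SaturatedGroundStatesFrequently (U δ : ℝ) : Prop :=
  ∃ᶠ L : ℕ in atTop, Even L ∧ ∃ ψ : Fock (Orb (FermionTorus 2 L)),
    IsGroundStateInSector (hubbardTorus 2 L 1 U) (2 * ⌊(1 - δ) * (L : ℝ) ^ 2 / 2⌋₊) 0 ψ ∧
      spinSq *ᵥ ψ = (((⌊(1 - δ) * (L : ℝ) ^ 2 / 2⌋₊ : ℝ) *
        ((⌊(1 - δ) * (L : ℝ) ^ 2 / 2⌋₊ : ℝ) + 1) : ℝ) : ℂ) • ψ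

/-- **A saturated ferromagnet has `T_R = 0` at every scale**: every local singlet pair `P_x` kills
it (tree: `NoGo.localPair_mulVec_eq_zero_of_saturated`, the `SU(2)` selection rule).
Tasaki, Prog. Theor. Phys. 99 (1998) 489, p. 20. [folklore] -/
theorem boxCorr_eq_zero_of_saturated (L : ℕ) [NeZero L] (R : ℕ) {n : ℕ}
    {ψ : Fock (Orb (FermionTorus 2 L))} (hN : IsNParticle (2 * n) ψ)
    (hS : spinSq *ᵥ ψ = (((n : ℝ) * ((n : ℝ) + 1) : ℝ) : ℂ) • ψ) :
    boxCorr L R ψ = 0 := by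
  have hS' : spinSq *ᵥ ψ =
      (((((2 * n : ℕ) : ℝ) / 2) * ((((2 * n : ℕ) : ℝ) / 2) + 1) : ℝ) : ℂ) • ψ := by
    rw [hS]; congr 2; push_cast; ring
  exact boxCorr_eq_zero_of_forall_localPair_eq_zero L R fun x =>
    Summit.HubbardSuperconductivity.NoGo.localPair_mulVec_eq_zero_of_saturated dWaveFormFactor L x hN hS'

/-- **Exclusion: the crux fails at every `(U, δ)` with saturated sector ground states along
infinitely many even sides.** (Normalise the saturated ground state; it is an admissible `ψ` with
`T_R = 0 < m R²` for the `R ≥ 1` the crux must supply at `R₀ = 1`.) So the witness `(U, δ)` of any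
proof lies where the `(N_L, 0)` ground states are eventually NOT saturated ferromagnets — the
Nagaoka corner is excluded, and so is every `(U, δ)` at which saturated and unsaturated ground
states are degenerate infinitely often. [folklore] -/
theorem mesoscopicPairOrderAt_false_of_saturated {U δ : ℝ} (hsat : SaturatedGroundStatesFrequently U δ) :
    ¬ MesoscopicPairOrderAt U δ := by
  rintro ⟨m, hm, hall⟩
  obtain ⟨R, hR, L₀, hL⟩ := hall 1
  obtain ⟨L, ⟨hEven, ψ, hgs, hS⟩, hLge⟩ :=
    (hsat.and_eventually (eventually_ge_atTop (max L₀ 1))).exists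
  have hL0 : L₀ ≤ L := le_of_max_le_left hLge
  have hL1 : 1 ≤ L := le_of_max_le_right hLge
  haveI : NeZero L := ⟨by omega⟩
  obtain ⟨c, hc, hc1⟩ := Literature.MathematicalPhysics.QuantumLattice.exists_smul_unit hgs.2.1
  have hgs' := Summit.HubbardSuperconductivity.NoGo.isGroundStateInSector_smul _ _ _ hgs hc
  have hN : IsNParticle (2 * ⌊(1 - δ) * (L : ℝ) ^ 2 / 2⌋₊) (c • ψ) :=
    ((mem_szSector_iff _ _ _).1 hgs'.1).1
  have hSc : spinSq *ᵥ (c • ψ) = (((⌊(1 - δ) * (L : ℝ) ^ 2 / 2⌋₊ : ℝ) *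
      ((⌊(1 - δ) * (L : ℝ) ^ 2 / 2⌋₊ : ℝ) + 1) : ℝ) : ℂ) • (c • ψ) := by
    rw [mulVec_smul, hS, smul_comm]
  have hbad := hL L hL0 hEven (c • ψ) hc1 hgs'
  rw [boxCorr_eq_zero_of_saturated L R hN hSc, zero_div] at hbad
  have hRpos : (1 : ℝ) ≤ R := by exact_mod_cast hR
  have hR2 : (1 : ℝ) ≤ (R : ℝ) ^ 2 := by nlinarith
  have hmR : m ≤ m * (R : ℝ) ^ 2 := le_mul_of_one_le_right hm.le hR2
  linarith

/-- Dual form: **at the witness `(U, δ)` of any proof, eventually (along even sides) NO sector ground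
state is a saturated ferromagnet.** [folklore] -/
theorem eventually_no_saturated_groundState_of_mesoscopicPairOrderAt {U δ : ℝ}
    (h : MesoscopicPairOrderAt U δ) :
    ∀ᶠ L : ℕ in atTop, Even L → ∀ ψ : Fock (Orb (FermionTorus 2 L)),
      IsGroundStateInSector (hubbardTorus 2 L 1 U) (2 * ⌊(1 - δ) * (L : ℝ) ^ 2 / 2⌋₊) 0 ψ →
        spinSq *ᵥ ψ ≠ (((⌊(1 - δ) * (L : ℝ) ^ 2 / 2⌋₊ : ℝ) *
          ((⌊(1 - δ) * (L : ℝ) ^ 2 / 2⌋₊ : ℝ) + 1) : ℝ) : ℂ) • ψ := by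
  have hns : ¬ SaturatedGroundStatesFrequently U δ :=
    fun hsat => mesoscopicPairOrderAt_false_of_saturated hsat h
  rw [SaturatedGroundStatesFrequently, Filter.not_frequently] at hns
  filter_upwards [hns] with L hL hE ψ hgs hS
  exact hL ⟨hE, ψ, hgs, hS⟩

/-- **The shape of a kill** (`H → ¬ crux` with `H` NOT claimed): saturated sector ground states
infinitely often at EVERY `(U, δ) ∈ (0, ∞) × (0, 1/2)` would refute the crux. `H` is physically
false at weak coupling (paramagnetic Fermi liquid / `d`-wave expected for `U ≲ 4`, `δ ≳ 0.3`); this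
is recorded as the reduction only — the honest unconditional target is `∀ U δ, ¬ MesoscopicPairOrderAt
U δ`, i.e. absence of `d`-wave order everywhere (route `NoGo`). [folklore] -/
theorem mesoscopicPairOrder_false_of_ubiquitous_saturation
    (h : ∀ U : ℝ, 0 < U → ∀ δ ∈ Set.Ioo (0:ℝ) (1 / 2), SaturatedGroundStatesFrequently U δ) :
    ¬ MesoscopicPairOrder := by
  rw [mesoscopicPairOrder_iff_exists_at]
  rintro ⟨U, hU, δ, hδ, hAt⟩
  exact mesoscopicPairOrderAt_false_of_saturated (h U hU δ hδ) hAt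

/-- `¬ crux` unfolded: the crux fails iff its pointwise body fails at EVERY admissible `(U, δ)`.
[folklore] -/
theorem not_mesoscopicPairOrder_iff :
    ¬ MesoscopicPairOrder ↔ ∀ U : ℝ, 0 < U → ∀ δ ∈ Set.Ioo (0:ℝ) (1 / 2), ¬ MesoscopicPairOrderAt U δ := by
  rw [mesoscopicPairOrder_iff_exists_at]
  constructor
  · intro h U hU δ hδ hAt
    exact h ⟨U, hU, δ, hδ, hAt⟩
  · rintro h ⟨U, hU, δ, hδ, hAt⟩
    exact h U hU δ hδ hAt

/-- **Pointwise necessity**: the summit's matrix at `(U, δ)` (catalogue def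
`Literature.Barriers.HubbardSuperconductivity.HasDWavePairFieldLROAt`) implies the crux at `(U, δ)`
(compactness bound `groundState_bound_of_forall_hasLRO` + Fejér floor `fejerBox_floor_pairField`,
exactly as the tree's global `mesoscopicPairOrder_of_hubbardSuperconductivity`). Hence a pointwise
disproof of the crux is a pointwise disproof of the summit. [folklore] -/
theorem mesoscopicPairOrderAt_of_hasDWavePairFieldLROAt {U δ : ℝ} (hδ : δ ∈ Set.Ioo (0:ℝ) (1 / 2))
    (h : Literature.Barriers.HubbardSuperconductivity.HasDWavePairFieldLROAt U δ) :
    MesoscopicPairOrderAt U δ := by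
  obtain ⟨c, hc, L₀, hbound⟩ :=
    Theorems.groundState_bound_of_forall_hasLRO U δ (by linarith [hδ.1]) h
  refine ⟨c, hc, fun R₀ => ⟨max R₀ 1, le_max_left _ _, max L₀ (2 * max R₀ 1), ?_⟩⟩
  intro L _ hL hE ψ hψ1 hgs
  set R : ℕ := max R₀ 1 with hRdef
  have hR : 0 < R := lt_of_lt_of_le Nat.one_pos (le_max_right _ _)
  have hRL : 2 * R ≤ L := le_of_max_le_right hL
  have hLpos : (0 : ℝ) < L := Nat.cast_pos.2 (Nat.pos_of_ne_zero (NeZero.ne L))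
  have hL2 : (0 : ℝ) < (L : ℝ) ^ 2 := by positivity
  have hfloor := Theorems.FunctionFieldCertificate.fejerBox_floor_pairField dWaveFormFactor L R hR hRL ψ
  have ha' := hbound L (le_of_max_le_left hL) hE ψ hgs hψ1
  change (R : ℝ) ^ 2 * _ / (L : ℝ) ^ 2 ≤ boxCorr L R ψ at hfloor
  rw [le_div_iff₀ hL2]
  rw [div_le_iff₀ hL2] at hfloor
  have hR2 : (0 : ℝ) ≤ (R : ℝ) ^ 2 := by positivity
  nlinarith [hfloor, ha', hR2]

/-- **No `d`-wave pair-field LRO (summit's matrix) at any `(U, δ)` with saturated sector ground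
states infinitely often along even sides** — the catalogue-level corollary (cf. the tree's
`NoGo.nogoNagaokaWindow_of_saturatedFerromagnetism`, here through the crux). [folklore] -/
theorem not_hasDWavePairFieldLROAt_of_saturated {U δ : ℝ} (hδ : δ ∈ Set.Ioo (0:ℝ) (1 / 2))
    (hsat : SaturatedGroundStatesFrequently U δ) :
    ¬ Literature.Barriers.HubbardSuperconductivity.HasDWavePairFieldLROAt U δ :=
  fun h => mesoscopicPairOrderAt_false_of_saturated hsat
    (mesoscopicPairOrderAt_of_hasDWavePairFieldLROAt hδ h)

/-! ### §3 Line `Sketch` (lead's pick): the chord-gap stub -/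

/-- The box pair repulsion `K_R = Σ_{x,y} W_R(y - x) P_xᴴ P_y` of line `Sketch`, verbatim. [folklore] -/
def boxRepulsion (L : ℕ) [NeZero L] (R : ℕ) :
    Matrix (Finset (Orb (FermionTorus 2 L))) (Finset (Orb (FermionTorus 2 L))) ℂ :=
  ∑ x : TorusSite 2 L, ∑ y : TorusSite 2 L,
    ((∏ i : Fin 2, max 0 (1 - |(((y i - x i).valMinAbs : ℤ) : ℝ)| / (R : ℝ)) : ℝ) : ℂ) •
      ((localPair dWaveFormFactor L x)ᴴ * localPair dWaveFormFactor L y)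

/-- `Re⟨ψ, K_R ψ⟩ = T_R(ψ)` (the landed stub `stub_boxExpectation`, p96295). [folklore] -/
theorem re_expect_boxRepulsion (L : ℕ) [NeZero L] (R : ℕ) (ψ : Fock (Orb (FermionTorus 2 L))) :
    (star ψ ⬝ᵥ boxRepulsion L R *ᵥ ψ).re = boxCorr L R ψ :=
  Theorems.FunctionFieldCertificate.stub_boxExpectation L R ψ

/-- **The open stub of line `Sketch` at fixed `(U, δ)`** (`stub_chordGap` after its two leading
existentials): an extensive chord gap `ε m R² L² ≤ E_K(H_L + ε K_R) - E_K(H_L)` for some `ε > 0`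
(allowed to depend on `L`), arbitrarily large `R`, all large even `L`. -/
def ChordGapAt (U δ : ℝ) : Prop :=
  ∃ m : ℝ, 0 < m ∧ ∀ R₀ : ℕ, ∃ R : ℕ, R₀ ≤ R ∧ ∃ L₀ : ℕ, ∀ (L : ℕ) [NeZero L], L₀ ≤ L → Even L →
    ∃ ε : ℝ, 0 < ε ∧
      ε * (m * (R : ℝ) ^ 2 * (L : ℝ) ^ 2) ≤
        (hubbardTorus 2 L 1 U + (ε : ℂ) • boxRepulsion L R).minEnergyOn
            (szSector (2 * ⌊(1 - δ) * (L : ℝ) ^ 2 / 2⌋₊) 0) -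
          (hubbardTorus 2 L 1 U).minEnergyOn (szSector (2 * ⌊(1 - δ) * (L : ℝ) ^ 2 / 2⌋₊) 0)

/-- The statement of the lead's `stub_chordGap` (Lines/Sketch.lean, verbatim) is
`∃ U > 0, ∃ δ ∈ (0,1/2), ChordGapAt U δ` (definitional). [folklore] -/
theorem stub_chordGap_statement_iff :
    (∃ U : ℝ, 0 < U ∧ ∃ δ ∈ Set.Ioo (0:ℝ) (1 / 2), ∃ m : ℝ, 0 < m ∧
      ∀ R₀ : ℕ, ∃ R : ℕ, R₀ ≤ R ∧ ∃ L₀ : ℕ, ∀ (L : ℕ) [NeZero L], L₀ ≤ L → Even L → ∃ ε : ℝ, 0 < ε ∧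
        ε * (m * (R : ℝ) ^ 2 * (L : ℝ) ^ 2) ≤
          (hubbardTorus 2 L 1 U + (ε : ℂ) • (∑ x : TorusSite 2 L, ∑ y : TorusSite 2 L,
              ((∏ i : Fin 2, max 0 (1 - |(((y i - x i).valMinAbs : ℤ) : ℝ)| / (R : ℝ)) : ℝ) : ℂ) •
                ((localPair dWaveFormFactor L x)ᴴ * localPair dWaveFormFactor L y))).minEnergyOn
              (szSector (2 * ⌊(1 - δ) * (L : ℝ) ^ 2 / 2⌋₊) 0) -
            (hubbardTorus 2 L 1 U).minEnergyOn (szSector (2 * ⌊(1 - δ) * (L : ℝ) ^ 2 / 2⌋₊) 0)) ↔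
    ∃ U : ℝ, 0 < U ∧ ∃ δ ∈ Set.Ioo (0:ℝ) (1 / 2), ChordGapAt U δ :=
  Iff.rfl

/-- **Joint sufficiency of the line is honest, pointwise**: `ChordGapAt U δ → MesoscopicPairOrderAt U δ`
with the SAME `(m, R, L₀)`, through the two LANDED stubs (`stub_chordFloor` p96247: the chord lies
below the tangent at any normalised sector ground state; `stub_boxExpectation` p96295). This is the
lead's `MesoscopicPairOrder_of` with the outer existentials peeled — no gap is smuggled by the
composition. [folklore] -/
theorem mesoscopicPairOrderAt_of_chordGapAt {U δ : ℝ} (h : ChordGapAt U δ) : MesoscopicPairOrderAt U δ := by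
  obtain ⟨m, hm, hall⟩ := h
  refine ⟨m, hm, fun R₀ => ?_⟩
  obtain ⟨R, hR₀, L₀, hL⟩ := hall R₀
  refine ⟨R, hR₀, L₀, ?_⟩
  intro L _ hL₀ hE ψ hψ hgs
  obtain ⟨ε, hε, hgap⟩ := hL L hL₀ hE
  have hchord := Theorems.FunctionFieldCertificate.stub_chordFloor L U ε
    (2 * ⌊(1 - δ) * (L : ℝ) ^ 2 / 2⌋₊) (boxRepulsion L R) ψ hε hψ hgs
  rw [re_expect_boxRepulsion L R ψ] at hchord
  have hLpos : (0 : ℝ) < L := Nat.cast_pos.2 (Nat.pos_of_ne_zero (NeZero.ne L))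
  rw [le_div_iff₀ (by positivity)]
  have key : ε * (m * (R : ℝ) ^ 2 * (L : ℝ) ^ 2) ≤ ε * boxCorr L R ψ := hgap.trans hchord
  have := le_of_mul_le_mul_left key hε
  linarith

/-- **The stub dies on the exclusion region too**: saturated sector ground states infinitely often
along even sides at `(U, δ)` ⇒ `¬ ChordGapAt U δ` (the saturated ground state is a trial state of
the penalised problem with `⟨K_R⟩ = 0`, so the chord gap is `≤ 0`). [folklore] -/
theorem chordGapAt_false_of_saturated {U δ : ℝ} (hsat : SaturatedGroundStatesFrequently U δ) :
    ¬ ChordGapAt U δ :=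
  fun h => mesoscopicPairOrderAt_false_of_saturated hsat (mesoscopicPairOrderAt_of_chordGapAt h)

/-! ### §4 Why it resists — the target and the obstruction (no `sorry` is kept in this file)

TARGET (not attempted as a theorem): `¬ MesoscopicPairOrder`, i.e. by `not_mesoscopicPairOrder_iff`
`∀ U > 0, ∀ δ ∈ (0,1/2), ¬ MesoscopicPairOrderAt U δ`, which by
`mesoscopicPairOrderAt_of_hasDWavePairFieldLROAt` contains `∀ U δ, ¬ HasDWavePairFieldLROAt U δ` —
the negation of the summit at every point — and is implied by nothing weaker that is known.

OBSTRUCTIONS MET (cycle 1):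
* No finite computation reaches it: the crux hides every finite `L` behind `∃ L₀`, and every finite
  `R` behind `∀ R₀ ∃ R ≥ R₀`; small-torus exact diagonalisation (≤ 4×4 at these densities) cannot
  even falsify a single instance, let alone the `L → ∞` statement.
* The only state-independent handles on "every sector ground state" in the tree are symmetry
  selection rules (`SU(2)`: §2; particle–hole maps `δ ↦ -δ`, outside the range; the `D₄`/translation
  quantum numbers of a ground state do not constrain `T_R`, a scalar under all of them).
* Known rigorous absence results do not bite: `GeneralizedHartreeFockNoPairing` (BLS) is about
  quasi-free minimisers, not ground states; high-temperature / 1D decay (Koma–Tasaki) is irrelevant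
  at `T = 0`, `d = 2`; `PositiveTemperatureNoPairLRO` (Hohenberg–Mermin–Wagner) is `T > 0` only;
  Nagaoka–Tasaki ferromagnetism is `U = ∞` with ONE hole (zero density), so
  `SaturatedGroundStatesFrequently U δ` is not available at any fixed `(U, δ)` of the range.
  CHECKED IN PRINT (lit read doi:10.1103/physrevb.58.117 = arXiv:cond-mat/9801243, pp. 1, 7–8):
  Su–Suzuki, "Nonexistence of d_{x²-y²} superconductivity in the Hubbard model", PRB 58 (1998) 117,
  is a Bogoliubov-inequality (Mermin–Wagner) theorem — no `d`-wave pairing quasi-average at ANY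
  NONZERO temperature, and at `T = 0` only "if an excited energy gap opens in the charge excitation
  spectrum" (an insulator hypothesis, uniform in `L`; the doped sector is metallic and the finite-`L`
  gap is not uniform) — so despite its title it does not touch the crux; same for Su, PRL 86 (2001)
  3690 (a comment on DCA numerics) and Matuttis–Ito, IJMPC 16 (2005) (QMC, numerical).
* Numerics (not proofs) point both ways across the range: stripes and no SC at `U ∈ [6, 8]`,
  `δ = 1/8` and `Δ_∞ = 0.006(4)` at `(4, 1/6)` (Qin et al. 2020; catalogue
  `PureModelStripeCompetition`), versus weak-coupling `d`-wave instability for `U ≲ 4`, `δ ≳ 0.3`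
  (Raghu–Kivelson–Scalapino PRB 81 (2010) 224505; Deng–Kozik–Prokof'ev–Svistunov EPL 110 (2015)
  57001) with an exponentially small margin. A kill needs absence EVERYWHERE, including that
  weak-coupling corner where the physics community expects the crux to be TRUE.

NEXT REGIMES TO TRY (cycle 2 if granted): (i) the `U`-INDEPENDENT structure at fixed `L` — open-shell
degeneracies of the free torus persist for small `U` by upper semicontinuity? no: `∃ L₀` kills it;
(ii) an `η`-pairing / pseudospin selection rule analogous to §2 for CHARGE `SU(2)` (only at half
filling or bipartite `μ`-shifted models — the route's `δ > 0` breaks it); (iii) QUANTITATIVE SPIN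
SELECTION RULE — worked out on paper this cycle and found TOO WEAK beyond `k = 0` (recorded so nobody
redoes it): with `b_{xy} = c_{x↑}c_{y↓} - c_{x↓}c_{y↑}` (`x ≠ y`, `b_{yx} = b_{xy}`) one has
`b_{xy}ᴴ b_{xy} = 2(n_x n_y/4 - S_x·S_y) ≥ 0` and the all-pairs sum rule
`Σ_{x ≠ y ordered} (n_x n_y/4 - S_x·S_y) = N̂²/4 + N̂/2 - 2D̂ - S²` (`D̂ = Σ_x n_{x↑}n_{x↓}`; at `S = N/2`
this forces `D̂ = 0` and total `0`, consistent with §2). For a `2n`-particle `ψ` with spin `S = n - k`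
the singlet content is `k(2n - k + 1) - 2⟨D̂⟩ ≤ k(2n + 1)` — EXTENSIVE already at `k = 1` (one magnon is
in a singlet with everything). Bounding the nearest-neighbour part by the all-pairs sum and using
`‖P_x ψ‖² ≤ 2 Σ_e ‖b_{x,x+e} ψ‖²` and §1d gives only `T_R(ψ) ≤ 4 R² k (2n + 1)`, i.e.
`m ≤ 4k(2n+1)/L² ≈ 4(1-δ)·k` for the minimal spin deficiency `k = N/2 - S` occurring i.o. among
ground states: vacuous for `k ≥ 1` (`m ≤ 32` anyway, physically `m ≲ 10⁻²`), and `k = 0` is §2. A useful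
version needs LOCALITY of the spin deficiency (magnon localisation near holes?), not a sum rule.
(iv) The lead's scale ladder (PICKED.md c1: `T_{kR}/(kR)² ≤ T_R/R²`, every-scale form) will hand a
FIXED-RANGE target `liminf_L min_GS T_R/(R²L²)` at one `R`; at `R = 1`, `T_1(ψ) = Σ_x ‖P_x ψ‖²` is the
local pair weight of §1d, whose ground-state infimum is again controlled only by §2-type information.
-/

end Summit.HubbardSuperconductivity.HubbardSuperconductivity.Cruxes.MesoscopicPairOrder.Disproof
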